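import Summits.QuantumFields.YangMills.Theorems.BalabanUVNodesN26AtRecord11
import Summits.QuantumFields.YangMills.Theses.BalabanUVNodes

/-!
# EVIDENCE SKETCH (memo cell `ym-nodeO-ideate`, lens P3 «weaken the target», seat P3 g25 = planner-ym-nodeO-ideate-p3-g25-0, 2026-08-26)
# K2 `EndpointGivenBR11` (stmt-QuantumFields-19675) FROM THE TREE's N25 ∕ (D4)-LANE VOCABULARY, BY NAME — `--supports`-class evidence, NOT a landing

PURPOSE (memo `ym-nodeO-ideate/memos/ROUTE-P3.md` v3.33 §22 (E), «two supplies of the same K2 meet at the objects»): place the TREE's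
(D4)-lane output on the lens's chain BY NAME, over TREE declarations only (no memo-cell definition is used):
* `endpointGivenBR11_of_sN25` — the cluster split's N25 ∀-END face `YMDAG.UVSplit.S_N25` at `Rec := IsRecordOfRecord₁₁C · 2` GIVES K2 in one line,
  (B) and the window UNUSED (the lens verdict: the weakest sufficient statements for K2 are (B)-free);
* `sN25_rec11_of_rec10` — «whoever closes N25's ∀-form over ₁₀C closes it over ₁₁C» (the N25 analogue of dag-n26-c's
  `n26_B4lit_rec11C_of_rec10C`, via its `endpointExistence_datumOfRecord₁₁_iff_stage10` and def-T's `exists_world_isRecordOfRecord₁₀C`);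
* `endpointGivenBR11_of_d4Package` — dag-n26-c's ONE (D1)-residue + (D4)-socket package asked of every admissible Stage-11 parameter
  (the hypothesis of `s_N25_and_n26_B4lit_rec11C`, verbatim at `N = 2`) GIVES K2 BY NAME: the FAN-OUT N25∕N26 lane reaches the live crux today
  with tree theorems + one line.  Its hypotheses name def-B's `mergedTermFamilyMatT … (TcOfRecord …) (chiFixed7 θ.ν) θ.εbg` — the SAME objects the
  class road's socket `MemberKernelFaceWθ ℰRc` reads (memo §18 (b), §22 (E)); instance 0∕1 for Bałaban's family on both roads.
HONEST: nothing of Bałaban's asserted; no inhabitant of `S_N25`, of the package, or of K2 is claimed; N25 ∕ N26 ∕ NODE O NOT discharged; count-neutral.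
-/

namespace YMNodeOIdeate.P3.K2Knit

open scoped Matrix.Norms.L2Operator

open Literature.MathematicalPhysics.QuantumFieldTheory.Balaban1983to89
open Literature.MathematicalPhysics.QuantumFieldTheory.Balaban1983to89.FlowStep
open Literature.MathematicalPhysics.QuantumFieldTheory.Balaban1983to89.DagBinding (EndpointExistence WorldP)
open Literature.MathematicalPhysics.QuantumFieldTheory.Balaban1983to89.T4Continuum (T4Family FiniteEpsData)
open Literature.MathematicalPhysics.QuantumFieldTheory.Balaban1983to89.Node00
open Literature.MathematicalPhysics.QuantumFieldTheory.Balaban1983to89.B13ScaleTransfer (Pt)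
open Literature.MathematicalPhysics.QuantumFieldTheory.Balaban1983to89.Beta.RemainderChainLattice
open Literature.MathematicalPhysics.QuantumFieldTheory.Balaban1983to89.Beta.RemainderLimitTorus (LDom limKernel)
open Literature.MathematicalPhysics.QuantumFieldTheory.Balaban1983to89.Beta.RemainderDecay190
open Literature.MathematicalPhysics.QuantumFieldTheory.Balaban1983to89.Beta.RemainderLocalityHolo (PolLeavesTFac190H)
open Literature.MathematicalPhysics.QuantumFieldTheory.Balaban1983to89.Beta.RemainderDecay190HoloChain (ChainTFac190H)
open Literature.MathematicalPhysics.QuantumFieldTheory.Balaban1983to89.Beta.OneStepKernelFamily (TbalOf)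
open Literature.MathematicalPhysics.QuantumFieldTheory.Balaban1983to89.Beta.OneStepResolventKernel (JetData)
open Summit.QuantumFields.BalabanUV.Gaps
open Summit.QuantumFields.BalabanUV.Gaps.BetaContFromD4Chain
open Summit.QuantumFields.YangMills.Theorems.BalabanUVNodesN26Merged (atSlopeCont_betaOfMerged)
open Summit.QuantumFields.YangMills.Theorems.BalabanUVNodesN26AtBetaC (betaContH_betaOfRecord₉c_iff n26lit_betaOfRecord₉c_of_localizedRep)
open Summit.QuantumFields.YangMills.Theorems.BalabanUVNodesN26AtRecord9 (endpointExistence_congr n26_B4lit_of_betaShadow)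
open Filter Topology
open Summit.QuantumFields.YangMills.Theorems.BalabanUVNodesN26AtRecord11
open Summit.QuantumFields.YangMills.Theses.BalabanUVNodes (EndpointGivenBR11)

/-- The Stage-11 ∕ Stage-10 record predicates as cluster-split record predicates. -/
abbrev Rec11 (N : ℕ) [NeZero N] : YMDAG.UVSplit.RecordPred N := fun F D w => IsRecordOfRecord₁₁C F N D w
/-- … -/
abbrev Rec10 (N : ℕ) [NeZero N] : YMDAG.UVSplit.RecordPred N := fun F D w => IsRecordOfRecord₁₀C F N D w

/-- **N25's ∀-END FACE AT ₁₁C GIVES K2 BY NAME** — (B) and the window hypotheses of `EndpointGivenBR11` are discarded. -/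
theorem endpointGivenBR11_of_sN25 (h : YMDAG.UVSplit.S_N25 (Rec11 2)) : EndpointGivenBR11 :=
  fun F D w hR _ _ => h F D w hR

/-- **WHOEVER CLOSES N25's ∀-FORM OVER ₁₀C CLOSES IT OVER ₁₁C**: a ₁₁C record `(D, w)` is `datumOfRecord₁₁ θ hP`; the Stage-10 datum of
`θ.toStage9Params` is a ₁₀C record at a fresh world of the same window (`exists_world_isRecordOfRecord₁₀C`), and END transports ₁₀ ⇒ ₁₁ along
`endpointExistence_datumOfRecord₁₁_iff_stage10` (same flows).  NOT at the ₁₁ world itself (`IsRecordOfRecord₁₁C ↛ IsRecordOfRecord₁₀C` at the datum). -/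
theorem sN25_rec11_of_rec10 {N : ℕ} [NeZero N] (h : YMDAG.UVSplit.S_N25 (Rec10 N)) : YMDAG.UVSplit.S_N25 (Rec11 N) := by
  intro F D w hR
  obtain ⟨θ, hP, hθ, hD, -, hγ, -, -⟩ := hR
  obtain ⟨w', hw', -⟩ := exists_world_isRecordOfRecord₁₀C F N θ.toStage9Params hP.base hθ.toStage9 hγ
  subst hD
  exact (endpointExistence_datumOfRecord₁₁_iff_stage10 F N θ hP).2 (h F _ w' hw')

/-- … hence N25's ∀-form over ₁₀C gives K2 too. -/
theorem endpointGivenBR11_of_sN25_rec10 (h : YMDAG.UVSplit.S_N25 (Rec10 2)) : EndpointGivenBR11 :=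
  endpointGivenBR11_of_sN25 (sN25_rec11_of_rec10 h)

/-- **THE (D4)-LANE REACHES K2 BY NAME**: dag-n26-c's one (D1)-residue + (D4)-socket package, asked of every admissible Stage-11 parameter with
provisos realising the datum on the world's window (the hypothesis of `s_N25_and_n26_B4lit_rec11C`, verbatim at `N = 2`), gives
`EndpointGivenBR11` — through `S_N25 (IsRecordOfRecord₁₁C · 2)`.  Every conjunct of the package is a located hypothesis about def-B's merged term family
`mergedTermFamilyMatT F 2 (TcOfRecord F 2) (chiFixed7 F 2 θ.ν) θ.εbg` and (C-pt); instance 0∕1. -/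
theorem endpointGivenBR11_of_d4Package
    (hin : ∀ (F : T4Family) (D : FiniteEpsData F (Matrix.specialUnitaryGroup (Fin 2) ℂ)) (w : WorldP)
      (θ : Stage11Params F 2) (hP : θ.Provisos₁₁), θ.Admissible → D = datumOfRecord₁₁ F 2 θ hP → w.γ ≤ θ.γ →
      letI := θ.instVβ₁; letI := θ.instVβ₂; letI := θ.instιβ
      ∃ (Lc : ℕ) (_ : NeZero Lc) (Js : ℕ → JetData 3 Lc) (Nc : ℝ) (M : ℕ) (_ : NeZero M) (c : B13.Consts) (ℓ α₂ : ℝ)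
        (q : Consts190) (A1 : (k : ℕ) → (Fin (k + 1) → ℝ) → LDom 4 → Pt 4 → ℝ),
        (∀ j, beta0OfMerged (betaMerged F (mergedTermFamilyMatT F 2 (TcOfRecord F 2) (chiFixed7 F 2 θ.ν) θ.εbg) θ.ρ8 θ.bV) θ.v₀ j =
          B12Beta.secondMoment (TbalOf Lc Js j) 0 1) ∧
        D1Residue.Residue Lc Js Nc 0 1 ∧
        (∀ k, ∃ C δ₁ : ℝ, 0 < δ₁ ∧ B12Sec2to5.Decay510 (TbalOf Lc Js k 0 1) C δ₁) ∧
        (∀ k (p : Fin (k + 1) → ℝ), p ∈ Box w.γ k → ∀ z : Pt 4,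
          polLimit F (k + 1) (fun K => mergedTermFamilyMatT F 2 (TcOfRecord F 2) (chiFixed7 F 2 θ.ν) θ.εbg k p K) θ.ρ8 θ.bV 0 1 z =
            TbalOf Lc Js k 0 1 z + limKernel (A1 k p) z) ∧
        (∀ k (p : Fin (k + 1) → ℝ), p ∈ Box w.γ k → Nonempty (PolLeavesTFac190H 4 M (A1 k p) c ℓ α₂ q)) ∧
        CondsL 4 c ℓ ∧ c.R22gen ℓ ∧ q.Valid c.δ₀ ∧ SignsL c α₂ q.B₃ ∧
        c.ε₁ * remCoeffL 4 M c α₂ q.B₃ ≤ B12Normalization.stepBal Nc Lc ∧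
        (∀ k (z : Pt 4), ContinuousOn (fun p : Fin (k + 1) → ℝ =>
          polLimit F (k + 1) (fun K => mergedTermFamilyMatT F 2 (TcOfRecord F 2) (chiFixed7 F 2 θ.ν) θ.εbg k p K) θ.ρ8 θ.bV 0 1 z)
          (Box w.γ k))) :
    EndpointGivenBR11 :=
  endpointGivenBR11_of_sN25 (s_N25_and_n26_B4lit_rec11C hin).1

/-- … and the same package gives K2 ∧ N26's literal at ₁₁C (what the lane books: «N26 closes WITH N25»). -/
theorem endpointGivenBR11_and_n26_of_d4Package
    (hin : ∀ (F : T4Family) (D : FiniteEpsData F (Matrix.specialUnitaryGroup (Fin 2) ℂ)) (w : WorldP)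
      (θ : Stage11Params F 2) (hP : θ.Provisos₁₁), θ.Admissible → D = datumOfRecord₁₁ F 2 θ hP → w.γ ≤ θ.γ →
      letI := θ.instVβ₁; letI := θ.instVβ₂; letI := θ.instιβ
      ∃ (Lc : ℕ) (_ : NeZero Lc) (Js : ℕ → JetData 3 Lc) (Nc : ℝ) (M : ℕ) (_ : NeZero M) (c : B13.Consts) (ℓ α₂ : ℝ)
        (q : Consts190) (A1 : (k : ℕ) → (Fin (k + 1) → ℝ) → LDom 4 → Pt 4 → ℝ),
        (∀ j, beta0OfMerged (betaMerged F (mergedTermFamilyMatT F 2 (TcOfRecord F 2) (chiFixed7 F 2 θ.ν) θ.εbg) θ.ρ8 θ.bV) θ.v₀ j =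
          B12Beta.secondMoment (TbalOf Lc Js j) 0 1) ∧
        D1Residue.Residue Lc Js Nc 0 1 ∧
        (∀ k, ∃ C δ₁ : ℝ, 0 < δ₁ ∧ B12Sec2to5.Decay510 (TbalOf Lc Js k 0 1) C δ₁) ∧
        (∀ k (p : Fin (k + 1) → ℝ), p ∈ Box w.γ k → ∀ z : Pt 4,
          polLimit F (k + 1) (fun K => mergedTermFamilyMatT F 2 (TcOfRecord F 2) (chiFixed7 F 2 θ.ν) θ.εbg k p K) θ.ρ8 θ.bV 0 1 z =
            TbalOf Lc Js k 0 1 z + limKernel (A1 k p) z) ∧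
        (∀ k (p : Fin (k + 1) → ℝ), p ∈ Box w.γ k → Nonempty (PolLeavesTFac190H 4 M (A1 k p) c ℓ α₂ q)) ∧
        CondsL 4 c ℓ ∧ c.R22gen ℓ ∧ q.Valid c.δ₀ ∧ SignsL c α₂ q.B₃ ∧
        c.ε₁ * remCoeffL 4 M c α₂ q.B₃ ≤ B12Normalization.stepBal Nc Lc ∧
        (∀ k (z : Pt 4), ContinuousOn (fun p : Fin (k + 1) → ℝ =>
          polLimit F (k + 1) (fun K => mergedTermFamilyMatT F 2 (TcOfRecord F 2) (chiFixed7 F 2 θ.ν) θ.εbg k p K) θ.ρ8 θ.bV 0 1 z)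
          (Box w.γ k))) :
    EndpointGivenBR11 ∧ YMDAG.UVSplit.N26_B4lit (Rec11 2) :=
  ⟨endpointGivenBR11_of_sN25 (s_N25_and_n26_B4lit_rec11C hin).1, (s_N25_and_n26_B4lit_rec11C hin).2⟩

end YMNodeOIdeate.P3.K2Knit
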